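import Mathlib.Algebra.Group.Shrink
import Mathlib.Data.Countable.Small
import Literature.AnabelianGeometry.AbsoluteAnabelian.AbsTopISemiAbsolute
import Literature.AnabelianGeometry.AbsoluteAnabelian.GaloisSubextensionProofs
import Literature.AnabelianGeometry.SemiGraphs.ProSigmaCompletionExtend
import Literature.AnabelianGeometry.SemiGraphs.ProSigmaCompletionProfiniteExtend
import Literature.AnabelianGeometry.SemiGraphs.ProSigmaCompletionSlim
import Mathlib.Topology.Algebra.ClopenNhdofOne
import HarnessLib

/-!
# Free pro-`Σ` groups of finite rank: the universal-property predicate `IsFreeProOn` ([AbsTopI] Lem 4.5 (i))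
# IS the pro-`Σ` completion of the free group on the generators (`IsProSigmaCompletion`) — bridge and corollaries

S. Mochizuki, *Topics in Absolute Anabelian Geometry I: Generalities* (2012) [AbsTopI] (lit key
`paper:url-11ac98ba15fc`), Lemma 4.5 (i) p. 54 ("free pro-`Σ`"), [Mzk12] Rmk 1.1.3; and
*Semi-graphs of Anabelioids* (2006) [SemiAnbd] Example 2.10 p. 31 ("the maximal pro-`Σ` quotient of the
fundamental group").  The abc-iut tree carries TWO typings of the one classical notion "free pro-`Σ` group
of finite rank":

* layer L4 (abc-iut-L4-t4, `AbsTopISemiAbsolute.lean`): the PREDICATE `IsFreeProOn G S gens` — `G` is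
  pro-`Σ` and every assignment of the finitely many generators `gens : Fin n → G` into a finite discrete
  `Σ`-group extends UNIQUELY to a continuous homomorphism (the vocabulary of [AbsTopI] Lemma 4.5 (i),
  `CuspidalData.NonProperIffFree`, FACT-LIST F-0208);
* layers L3/L5 (abc-iut-L3, `SemiGraphs/Coverticial.lean`): the PREDICATE `IsProSigmaCompletion S ι` on
  a homomorphism `ι : Γ →* P` — dense image, `P` pro-`Σ`, and every normal subgroup of `Γ` of `Σ`-integer
  index is the pull-back of an open subgroup of `P` — in which the cell's theorems about pro-`Σ` free and
  surface groups are proved (slimness: abc-iut-L5-t9's `IsProSigmaCompletion.isSlimGroup`; elasticity: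
  the F-0239 chain over `isElastic_of_affine_rankFormula`).

THIS PROOF-ONLY FILE (no definitions, no named facts) proves that for a PROFINITE group `G` the two
coincide on the free group `F_n = FreeGroup (Fin n)`:

* `IsFreeProOn.isProSigmaCompletion_lift` — `IsFreeProOn G S gens → IsProSigmaCompletion S (FreeGroup.lift gens)`
  (density of `⟨gens⟩`: otherwise an open normal `N` with `⟨gens⟩·N ≠ G` yields TWO continuous extensions
  `G → G/N` of the generator assignment — the projection, and the one that factors through the image of a
  proper open subgroup — contradicting uniqueness; the finite quotient is moved to `Type` by
  `Shrink.mulEquiv`, as the L4 predicate tests against finite groups in `Type`; pro-`Σ` from `IsProSet`;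
  pull-backs: a normal `N ⊴ F_n` of `Σ`-index gives the finite `Σ`-group `F_n/N`, the continuous extension
  `φ : G → F_n/N` of `i ↦ [xᵢ]`, and `ker φ` pulls back to `N` by `FreeGroup.ext_hom`);
* `isFreeProOn_of_isProSigmaCompletion_lift` — the converse (existence of extensions:
  abc-iut-L3's `exists_continuous_extend_top`; uniqueness: density, `continuous_extend_profinite_unique`);
* `isFreeProOn_iff_isProSigmaCompletion_lift` — the equivalence;
* COROLLARIES BY NAME: `IsFreeProOn.isTopologicallyFinitelyGenerated`; `IsFreeProOn.isSlimGroup` — a free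
  pro-`Σ` group of rank `n ≥ 2` on a profinite group is SLIM ([AbsAnab] Lemma 1.3.1 affine case, via
  abc-iut-L5-t9's theorem for pro-`Σ` completions of nonabelian free groups).

HONEST FRAMING: classical profinite group theory (Ribes–Zalesskii §3.3); refereed, undisputed; nothing here
bears on [IUTchIII] Cor. 3.12; typed ≠ proved elsewhere.
-/

noncomputable section

open Topology

universe u

namespace Literature.AnabelianGeometry.AbsoluteAnabelian

open Literature.AnabelianGeometry.SemiGraphs.SemiGraphOfAnabelioids (IsProSigmaCompletion)
open Literature.AnabelianGeometry.SemiGraphs.SemiGraphOfAnabelioids.IsProSigmaCompletion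
open Literature.AnabelianGeometry.Anabelioids (IsSigmaInteger)
open Literature.AlgebraicGeometry.Frobenioids (IsSlimGroup)

variable {G : Type u} [Group G] [TopologicalSpace G] [IsTopologicalGroup G]
variable {S : Set ℕ} {n : ℕ} {gens : Fin n → G}

/-! ### Elementary unpacking of `IsFreeProOn` -/

omit [IsTopologicalGroup G] in
/-- Uniqueness clause of `IsFreeProOn`: two continuous homomorphisms to a finite discrete `Σ`-group that
agree on the generators are equal. [cite: MochizukiAbsTopI2012, Lemma 4.5 (i) p.54] -/
theorem IsFreeProOn.hom_ext (h : IsFreeProOn G S gens) {K : Type} [Group K] [Finite K]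
    [TopologicalSpace K] [DiscreteTopology K] (hK : ∀ q : ℕ, q.Prime → q ∣ Nat.card K → q ∈ S)
    {φ ψ : G →* K} (hφ : Continuous φ) (hψ : Continuous ψ) (hgen : ∀ i, φ (gens i) = ψ (gens i)) :
    φ = ψ := by
  obtain ⟨χ, -, hχu⟩ := h.2 K hK fun i => ψ (gens i)
  exact (hχu φ ⟨hφ, hgen⟩).trans (hχu ψ ⟨hψ, fun _ => rfl⟩).symm

/-- Pro-`Σ` clause of `IsFreeProOn` in the `IsSigmaInteger` form of the L3 interface: an open normal
subgroup of the compact group `G` has `Σ`-integer index. [cite: MochizukiAbsTopI2012, Lemma 4.5 (i) p.54] -/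
theorem IsFreeProOn.isSigmaInteger_index [CompactSpace G] (h : IsFreeProOn G S gens) (N : Subgroup G)
    (hN : N.Normal) (hNo : IsOpen (N : Set G)) : IsSigmaInteger S N.index := by
  haveI : Finite (G ⧸ N) := Subgroup.quotient_finite_of_isOpen N hNo
  haveI : N.FiniteIndex := Subgroup.finiteIndex_of_finite_quotient
  exact ⟨Nat.pos_of_ne_zero Subgroup.FiniteIndex.index_ne_zero,
    fun q hq hdvd => h.1.prime_dvd_index N hN hNo q hq hdvd⟩

omit [TopologicalSpace G] [IsTopologicalGroup G] in
/-- The generators lie in the range of `FreeGroup.lift gens`. [folklore] -/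
private theorem gens_mem_range_lift (i : Fin n) : gens i ∈ (FreeGroup.lift gens).range :=
  ⟨FreeGroup.of i, FreeGroup.lift_apply_of⟩

/-! ### From the universal property to the completion property -/

/-- **Density of the generated subgroup**: if `G` (profinite) is free pro-`Σ` on `gens` in the sense of
`IsFreeProOn`, then the subgroup generated by the `gens` — the range of `FreeGroup.lift gens` — is DENSE.
(Otherwise some open normal `N` has `⟨gens⟩ N ⊆ W ⊊ G` for an open subgroup `W`; the projection
`G → G/N` and the extension of `i ↦ [gens i]` through the proper subgroup `W/N` are two distinct
continuous extensions of the same generator assignment.) [cite: MochizukiAbsTopI2012, Lemma 4.5 (i) p.54] -/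
theorem IsFreeProOn.dense_range_lift [CompactSpace G] [T2Space G] [TotallyDisconnectedSpace G]
    (h : IsFreeProOn G S gens) : Dense (Set.range (FreeGroup.lift gens)) := by
  classical
  -- the closure `H` of the generated subgroup
  set H : Subgroup G := (FreeGroup.lift gens).range.topologicalClosure with hHdef
  have hHc : IsClosed (H : Set G) := Subgroup.isClosed_topologicalClosure _
  suffices hH : H = ⊤ by
    rw [dense_iff_closure_eq]
    have : ((H : Subgroup G) : Set G) = Set.univ := by rw [hH]; rfl
    rwa [hHdef, Subgroup.topologicalClosure_coe, MonoidHom.coe_range] at this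
  by_contra hH
  -- an open subgroup `W ⊇ H`, `W ≠ ⊤`
  have hsInf := ProfiniteGrp.closedSubgroup_eq_sInf_open ⟨H, hHc⟩
  obtain ⟨W, ⟨hWo, hHW⟩, hWtop⟩ : ∃ W ∈ {W : Subgroup G | IsOpen (W : Set G) ∧ H ≤ W}, W ≠ ⊤ := by
    by_contra hall
    push Not at hall
    apply hH
    change (⟨H, hHc⟩ : ClosedSubgroup G).toSubgroup = ⊤
    rw [hsInf]
    exact sInf_eq_top.mpr hall
  -- an open normal subgroup `N ≤ W`
  obtain ⟨N, hNW⟩ := ProfiniteGrp.exist_openNormalSubgroup_sub_open_nhds_of_one hWo W.one_mem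
  haveI hNn : (N : Subgroup G).Normal := N.isNormal'
  have hNo : IsOpen ((N : Subgroup G) : Set G) := N.isOpen'
  have hNW' : (N : Subgroup G) ≤ W := fun x hx => hNW hx
  -- the finite discrete `Σ`-group `G/N`, moved to `Type`
  haveI : Finite (G ⧸ (N : Subgroup G)) := Subgroup.quotient_finite_of_isOpen _ hNo
  haveI : DiscreteTopology (G ⧸ (N : Subgroup G)) := QuotientGroup.discreteTopology hNo
  set Q := G ⧸ (N : Subgroup G)
  let e : Shrink.{0} Q ≃* Q := Shrink.mulEquiv
  haveI : Finite (Shrink.{0} Q) := Finite.of_equiv Q e.toEquiv.symm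
  letI : TopologicalSpace (Shrink.{0} Q) := ⊥
  haveI : DiscreteTopology (Shrink.{0} Q) := ⟨rfl⟩
  have hcardQ : Nat.card (Shrink.{0} Q) = (N : Subgroup G).index := by
    rw [Nat.card_congr e.toEquiv]; rfl
  have hKS : ∀ q : ℕ, q.Prime → q ∣ Nat.card (Shrink.{0} Q) → q ∈ S := by
    rw [hcardQ]; exact (h.isSigmaInteger_index _ hNn hNo).2
  -- first extension: the projection
  let φ₁ : G →* Shrink.{0} Q := e.symm.toMonoidHom.comp (QuotientGroup.mk' (N : Subgroup G))
  have hφ₁ : ∀ g, φ₁ g = e.symm (QuotientGroup.mk g) := fun _ => rfl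
  have hmkc : Continuous (QuotientGroup.mk : G → Q) := QuotientGroup.continuous_mk
  have hec : Continuous (e.symm : Q → Shrink.{0} Q) := continuous_of_discreteTopology
  have hφ₁c : Continuous φ₁ := hec.comp hmkc
  -- second extension: through the image `M` of `W`
  let M : Subgroup (Shrink.{0} Q) := (W.map (QuotientGroup.mk' (N : Subgroup G))).comap e.toMonoidHom
  have hgensM : ∀ i, φ₁ (gens i) ∈ M := by
    intro i
    change e (e.symm (QuotientGroup.mk (gens i))) ∈ W.map (QuotientGroup.mk' (N : Subgroup G))
    rw [MulEquiv.apply_symm_apply]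
    exact ⟨gens i, hHW (Subgroup.le_topologicalClosure _ (gens_mem_range_lift i)), rfl⟩
  haveI : Finite M := inferInstance
  have hMS : ∀ q : ℕ, q.Prime → q ∣ Nat.card M → q ∈ S :=
    fun q hq hdvd => hKS q hq (hdvd.trans (Subgroup.card_subgroup_dvd_card M))
  obtain ⟨ψ', ⟨hψ'c, hψ'gens⟩, -⟩ := h.2 M hMS fun i => ⟨φ₁ (gens i), hgensM i⟩
  let ψ : G →* Shrink.{0} Q := M.subtype.comp ψ'
  have hψc : Continuous ψ := continuous_subtype_val.comp hψ'c
  have hψgens : ∀ i, φ₁ (gens i) = ψ (gens i) := fun i => by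
    change φ₁ (gens i) = ((ψ' (gens i) : M) : Shrink.{0} Q)
    rw [hψ'gens i]
  have heq : φ₁ = ψ := h.hom_ext hKS hφ₁c hψc hψgens
  -- hence every element of `G/N` lies in the image of `W`: `W = ⊤`
  apply hWtop
  rw [eq_top_iff]
  intro g _
  have hgM : φ₁ g ∈ M := by rw [heq]; exact (ψ' g).2
  change e (e.symm (QuotientGroup.mk g)) ∈ W.map (QuotientGroup.mk' (N : Subgroup G)) at hgM
  rw [MulEquiv.apply_symm_apply] at hgM
  have hg' : g ∈ (W.map (QuotientGroup.mk' (N : Subgroup G))).comap (QuotientGroup.mk' (N : Subgroup G)) :=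
    hgM
  rw [Subgroup.comap_map_eq, QuotientGroup.ker_mk', sup_eq_left.mpr hNW'] at hg'
  exact hg'

/-- **`IsFreeProOn ⇒ IsProSigmaCompletion`**: a profinite group `G` that is free pro-`Σ` on
`gens : Fin n → G` in the sense of the L4 universal-property predicate is the pro-`Σ` completion, in the
sense of the L3 interface, of the free group `F_n` along `FreeGroup.lift gens : F_n → G`.
[cite: MochizukiAbsTopI2012, Lemma 4.5 (i) p.54] -/
theorem IsFreeProOn.isProSigmaCompletion_lift [CompactSpace G] [T2Space G] [TotallyDisconnectedSpace G]
    (h : IsFreeProOn G S gens) : IsProSigmaCompletion S (FreeGroup.lift gens) := by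
  classical
  refine ⟨h.dense_range_lift, fun N hN hNo => h.isSigmaInteger_index N hN hNo, fun N hN hNS => ?_⟩
  -- the finite discrete `Σ`-group `F_n / N`
  haveI := hN
  haveI : N.FiniteIndex := ⟨Nat.pos_iff_ne_zero.mp hNS.1⟩
  haveI : Finite (FreeGroup (Fin n) ⧸ N) := Subgroup.finite_quotient_of_finiteIndex
  letI : TopologicalSpace (FreeGroup (Fin n) ⧸ N) := ⊥
  haveI : DiscreteTopology (FreeGroup (Fin n) ⧸ N) := ⟨rfl⟩
  have hKS : ∀ q : ℕ, q.Prime → q ∣ Nat.card (FreeGroup (Fin n) ⧸ N) → q ∈ S := hNS.2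
  obtain ⟨φ, ⟨hφc, hφgens⟩, -⟩ := h.2 (FreeGroup (Fin n) ⧸ N) hKS fun i => QuotientGroup.mk (FreeGroup.of i)
  refine ⟨φ.ker, ?_, ?_⟩
  · -- `ker φ` is open: `φ` is continuous into a discrete group
    change IsOpen (φ ⁻¹' {1})
    exact (isOpen_discrete _).preimage hφc
  · -- it pulls back to `N`: `φ ∘ lift gens = F_n → F_n/N` by `FreeGroup.ext_hom`
    have hcomp : φ.comp (FreeGroup.lift gens) = QuotientGroup.mk' N :=
      FreeGroup.ext_hom _ _ fun i => by
        rw [MonoidHom.comp_apply, FreeGroup.lift_apply_of, hφgens i, QuotientGroup.mk'_apply]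
    rw [MonoidHom.comap_ker, hcomp, QuotientGroup.ker_mk']

/-! ### From the completion property to the universal property -/

/-- **`IsProSigmaCompletion ⇒ IsFreeProOn`**: if `FreeGroup.lift gens : F_n → G` is a pro-`Σ` completion
(`G` profinite), then `G` is free pro-`Σ` on `gens` (extensions to finite `Σ`-groups exist by the
completion's universal property and are unique by density). [cite: MochizukiAbsTopI2012, Lemma 4.5 (i) p.54] -/
theorem isFreeProOn_of_isProSigmaCompletion_lift [CompactSpace G] [TotallyDisconnectedSpace G]
    (hι : IsProSigmaCompletion S (FreeGroup.lift gens)) : IsFreeProOn G S gens := by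
  classical
  refine ⟨⟨fun U hU hUo q hq hdvd => (hι.index_open U hU hUo).2 q hq hdvd⟩, ?_⟩
  intro K _ _ _ _ hK f
  haveI : Nonempty K := ⟨1⟩
  have hKS : IsSigmaInteger S (Nat.card K) := ⟨Nat.card_pos, hK⟩
  obtain ⟨φ, hφc, hφ⟩ := exists_continuous_extend_top hι hKS (FreeGroup.lift f)
  refine ⟨φ, ⟨hφc, fun i => ?_⟩, ?_⟩
  · rw [← FreeGroup.lift_apply_of (f := gens) (x := i), hφ, FreeGroup.lift_apply_of]
  · rintro ψ ⟨hψc, hψ⟩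
    refine continuous_extend_profinite_unique hι hψc hφc fun γ => ?_
    have hcomp : ψ.comp (FreeGroup.lift gens) = φ.comp (FreeGroup.lift gens) :=
      FreeGroup.ext_hom _ _ fun i => by
        rw [MonoidHom.comp_apply, MonoidHom.comp_apply, hφ, FreeGroup.lift_apply_of,
          FreeGroup.lift_apply_of, hψ i]
    exact DFunLike.congr_fun hcomp γ

/-- **The two typings of "free pro-`Σ` of finite rank" agree** on profinite groups: the L4 universal
property `IsFreeProOn G S gens` ([AbsTopI] Lemma 4.5 (i)) holds iff `FreeGroup.lift gens : F_n → G` is a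
pro-`Σ` completion in the sense of the L3 interface ([SemiAnbd] Example 2.10).
[cite: MochizukiAbsTopI2012, Lemma 4.5 (i) p.54] -/
theorem isFreeProOn_iff_isProSigmaCompletion_lift [CompactSpace G] [T2Space G] [TotallyDisconnectedSpace G] :
    IsFreeProOn G S gens ↔ IsProSigmaCompletion S (FreeGroup.lift gens) :=
  ⟨IsFreeProOn.isProSigmaCompletion_lift, isFreeProOn_of_isProSigmaCompletion_lift⟩

/-! ### Corollaries by name -/

/-- A free pro-`Σ` group of finite rank (profinite) is topologically finitely generated: the generators
generate a dense subgroup. [cite: MochizukiAbsTopI2012, Prop 2.2 p.18] -/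
theorem IsFreeProOn.isTopologicallyFinitelyGenerated [CompactSpace G] [T2Space G] [TotallyDisconnectedSpace G]
    (h : IsFreeProOn G S gens) : IsTopologicallyFinitelyGenerated G := by
  classical
  refine ⟨⟨Finset.univ.image gens, ?_⟩⟩
  apply SetLike.coe_injective
  rw [Subgroup.topologicalClosure_coe, Subgroup.coe_top, Finset.coe_image, Finset.coe_univ,
    Set.image_univ, ← FreeGroup.range_lift_eq_closure, MonoidHom.coe_range]
  exact h.dense_range_lift.closure_eq

omit [TopologicalSpace G] [IsTopologicalGroup G] in
/-- Two distinct free generators of `F_n` do not commute (seen in `S₃`). [folklore] -/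
private theorem freeGroup_of_mul_of_ne {i j : Fin n} (hij : i ≠ j) :
    (FreeGroup.of i : FreeGroup (Fin n)) * FreeGroup.of j ≠ FreeGroup.of j * FreeGroup.of i := by
  classical
  let f : Fin n → Equiv.Perm (Fin 3) := fun c =>
    if c = i then Equiv.swap 0 1 else if c = j then Equiv.swap 1 2 else 1
  have hfi : f i = Equiv.swap 0 1 := by simp [f]
  have hfj : f j = Equiv.swap 1 2 := by simp [f, Ne.symm hij]
  intro hc
  have h' := congrArg (FreeGroup.lift f) hc
  simp only [map_mul, FreeGroup.lift_apply_of, hfi, hfj] at h'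
  exact absurd h' (by decide)

/-- **A free pro-`Σ` group of rank `n ≥ 2` is SLIM** ([AbsAnab] Lemma 1.3.1, affine case; [AbsTopI]
Prop 2.3 (i) slim half for `Δ` free pro-`Σ`): via the bridge and abc-iut-L5-t9's
`IsProSigmaCompletion.isSlimGroup` for pro-`Σ` completions of nonabelian free groups.
[cite: MochizukiAbsTopI2012, Prop 2.3 (i) p.19] -/
theorem IsFreeProOn.isSlimGroup [CompactSpace G] [T2Space G] [TotallyDisconnectedSpace G]
    (h : IsFreeProOn G S gens) (hn : 2 ≤ n) : IsSlimGroup G := by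
  have hne : (⟨0, by omega⟩ : Fin n) ≠ ⟨1, by omega⟩ := by simp [Fin.ext_iff]
  exact IsProSigmaCompletion.isSlimGroup
    ⟨FreeGroup.of ⟨0, by omega⟩, FreeGroup.of ⟨1, by omega⟩, freeGroup_of_mul_of_ne hne⟩
    h.isProSigmaCompletion_lift

/-- The rank-free form: a profinite group that is free pro-`Σ` of SOME finite rank `≥ 2` is slim.
[cite: MochizukiAbsTopI2012, Prop 2.3 (i) p.19] -/
theorem isSlimGroup_of_isFreeProOn [CompactSpace G] [T2Space G] [TotallyDisconnectedSpace G]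
    (h : ∃ (n : ℕ) (gens : Fin n → G), 2 ≤ n ∧ IsFreeProOn G S gens) : IsSlimGroup G := by
  obtain ⟨n, gens, hn, h⟩ := h
  exact h.isSlimGroup hn

end Literature.AnabelianGeometry.AbsoluteAnabelian

end
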